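import Summits.MatrixMultiplication.OmegaCensus.STPPVosperSlackOneTwoRuns

/-!
# ω-census (abelian STPP census): two windows — the case-β₂ TABLE for a block with `b = 2` (kernel)

HONEST FRAMING (pub-omega census; verbatim): lottery ticket; floor = certified bounds/negative ranges.
Census STRUCTURE (seat pub-omega-stpp-1 gen 30, 2026-08-28), family (b2).  Tools for the slack-1 Vosper law at a block with `b = |Bᵢ| = 2` in case β
(`|Bᵢ + V| = |V| + 2`): `Bᵢ = {β, β + e′}`, so the two-run structure (`two_runs_of_card_union_vadd`) makes `V = W ⊔ (Sn + Y°)` the union of TWO maximal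
`e′`-runs `V₁ ⊔ V₂`; transported by `x ↦ e′⁻¹(x − v₁)` they become the windows `[0, n₁)` and `s₂ + [0, n₂)`; the blocks of `W` are PAIRS `{g, g+1}`, each
inside one window (the successor of each window's last point is outside `V`), so the prefix law with run length `2` holds separately in each window for the
points of the progression `Sn + Y°`.  Nothing here is progress on `ω`.

## Contents

* `succ_end_not_mem_of_two_runs` — in the two-run decomposition the successor of each run's last term is outside the set.
* `posList`, `nextPosL`, `oddMinAuxL`/`oddMinL` + `le_oddMinL`, `outMaxL`, `tableBeta2S`/`tableBeta2Core`/`tableBeta2 p n m J` (`Bool`; the position list and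
  the bound are passed as arguments so the kernel evaluates them once per `(j,t)`; the `s`-loop runs only over the admissible range) with its meaning `tableBeta2_spec`.
* (the transport step `two_windows_ratio_val_mem` is in `STPPVosperSlackOneTwoWindows.lean`).

References: A. G. Vosper, J. London Math. Soc. 31 (1956); M. B. Nathanson, GTM 165, §2.5; H. Cohn, R. Kleinberg, B. Szegedy, C. Umans, FOCS 2005
(arXiv:math/0511460), Def. 5.1.
-/

open Finset
open scoped Pointwise

namespace Summit.MatrixMultiplication.OmegaCensus.CubeNB

open Literature.Computability.AlgebraicComplexity
open Literature.Combinatorics.Additive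
open Summit.MatrixMultiplication.OmegaCensus.STPPKneser

/-! ## §1 Ends of the two runs -/

section Ends

variable {p : ℕ} [hp : Fact p.Prime]

/-- `d + {c + i d : i < ℓ} ⊆ {c + i d : i < ℓ} ∪ {c + ℓ d}`. [folklore] -/
theorem vadd_apFinset_subset_insert (c d : ZMod p) (ℓ : ℕ) :
    d +ᵥ apFinset c d ℓ ⊆ insert (c + ℓ • d) (apFinset c d ℓ) := by
  intro x hx
  rw [mem_vadd_finset] at hx
  obtain ⟨y, hy, rfl⟩ := hx
  obtain ⟨i, hi, rfl⟩ := mem_apFinset.1 hy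
  rw [vadd_eq_add, mem_insert, mem_apFinset]
  by_cases h : i + 1 < ℓ
  · exact Or.inr ⟨i + 1, h, by rw [succ_nsmul]; abel⟩
  · left
    have : i + 1 = ℓ := by omega
    rw [← this, succ_nsmul]; abel

/-- **Ends of the two runs.**  If `X = {c₁ + i d} ∪ {c₂ + i d}` (`ℓ₁ + ℓ₂ = |X|` terms) and `|X ∪ (d + X)| = |X| + 2`, then `c₁ + ℓ₁ d ∉ X` and
`c₂ + ℓ₂ d ∉ X` (otherwise `d + X ⊆ X ∪ {one point}`). [folklore] -/
theorem succ_end_not_mem_of_two_runs {X : Finset (ZMod p)} {d c₁ c₂ : ZMod p} {ℓ₁ ℓ₂ : ℕ}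
    (hX : X = apFinset c₁ d ℓ₁ ∪ apFinset c₂ d ℓ₂) (h : (X ∪ (d +ᵥ X)).card = X.card + 2) :
    c₁ + ℓ₁ • d ∉ X ∧ c₂ + ℓ₂ • d ∉ X := by
  have hsub : d +ᵥ X ⊆ insert (c₁ + ℓ₁ • d) (insert (c₂ + ℓ₂ • d) X) := by
    rw [hX, Finset.vadd_finset_union]
    intro x hx
    rcases mem_union.1 hx with h1 | h2
    · have := vadd_apFinset_subset_insert c₁ d ℓ₁ h1
      rw [mem_insert] at this
      rcases this with h | h
      · exact mem_insert.2 (Or.inl h)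
      · exact mem_insert_of_mem (mem_insert_of_mem (mem_union_left _ h))
    · have := vadd_apFinset_subset_insert c₂ d ℓ₂ h2
      rw [mem_insert] at this
      rcases this with h | h
      · exact mem_insert_of_mem (mem_insert.2 (Or.inl h))
      · exact mem_insert_of_mem (mem_insert_of_mem (mem_union_right _ h))
  constructor
  · intro hmem
    have hsub' : X ∪ (d +ᵥ X) ⊆ insert (c₂ + ℓ₂ • d) X := by
      apply union_subset (subset_insert _ _)
      intro x hx
      have := hsub hx
      rw [mem_insert] at this
      rcases this with rfl | h'
      · exact mem_insert_of_mem hmem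
      · exact h'
    have := (card_le_card hsub').trans (card_insert_le _ _)
    omega
  · intro hmem
    have hsub' : X ∪ (d +ᵥ X) ⊆ insert (c₁ + ℓ₁ • d) X := by
      apply union_subset (subset_insert _ _)
      intro x hx
      have := hsub hx
      rw [mem_insert, mem_insert] at this
      rcases this with h' | rfl | h'
      · exact mem_insert.2 (Or.inl h')
      · exact mem_insert_of_mem hmem
      · exact mem_insert_of_mem h'
    have := (card_le_card hsub').trans (card_insert_le _ _)
    omega

end Ends

/-! ## §2 The case-β₂ table: a progression across two windows -/

section TableTwoWindows

/-- Counting bridge: the cardinal of a filtered `range` is the length of the filtered `List.range` (definitionally). [folklore] -/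
theorem card_filter_range_eq_length (P : ℕ → Prop) [DecidablePred P] (m : ℕ) :
    #((range m).filter P) = ((List.range m).filter fun i => decide (P i)).length := rfl

/-- `min` over a list with a default: `n₁ ≤` the fold if `n₁ ≤` every value and `n₁ ≤` the default. [folklore] -/
theorem le_foldr_min {l : List ℕ} {f : ℕ → ℕ} {n₁ n : ℕ} (h : ∀ k ∈ l, n₁ ≤ f k) (hn : n₁ ≤ n) :
    n₁ ≤ l.foldr (fun k acc => min (f k) acc) n := by
  induction l with
  | nil => simpa using hn
  | cons a l ih =>
    simp only [List.foldr_cons]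
    exact le_min (h a (by simp)) (ih fun k hk => h k (by simp [hk]))

/-- A `foldr` of `max` with default `d` is `≤ B` if every value and `d` are. [folklore] -/
theorem foldr_max_le {l : List ℕ} {f : ℕ → ℕ} {B d : ℕ} (h : ∀ k ∈ l, f k ≤ B) (hd : d ≤ B) :
    l.foldr (fun k acc => max (f k) acc) d ≤ B := by
  induction l with
  | nil => simpa using hd
  | cons a l ih =>
    simp only [List.foldr_cons]
    exact max_le (h a (by simp)) (ih fun k hk => h k (by simp [hk]))

/-- A `foldr` of `min` with default `d` returns `d` or one of the values. [folklore] -/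
theorem foldr_min_eq_or_mem (l : List ℕ) (f : ℕ → ℕ) (d : ℕ) :
    l.foldr (fun k acc => min (f k) acc) d = d ∨ ∃ k ∈ l, l.foldr (fun k acc => min (f k) acc) d = f k := by
  induction l with
  | nil => left; rfl
  | cons a l ih =>
    simp only [List.foldr_cons]
    rcases min_choice (f a) (l.foldr (fun k acc => min (f k) acc) d) with h | h
    · right; exact ⟨a, by simp, h⟩
    · rw [h]
      rcases ih with h1 | ⟨k, hk, h2⟩
      · left; exact h1
      · right; exact ⟨k, by simp [hk], h2⟩

/-- The list of positions `(t + j k) mod p`, `k < m` (computed once per `(j, t)`). [folklore] -/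
def posList (p m j t : ℕ) : List ℕ := (List.range m).map fun k => (t + j * k) % p

/-- Membership in `posList`. [folklore] -/
theorem mem_posList {p m j t x : ℕ} : x ∈ posList p m j t ↔ ∃ k, k < m ∧ (t + j * k) % p = x := by
  simp only [posList, List.mem_map, List.mem_range]

/-- Counting bridge for `posList`: `#(filter over positions) = #(filter over indices)`. [folklore] -/
theorem length_filter_posList (p m j t : ℕ) (q : ℕ → Bool) :
    ((posList p m j t).filter q).length = ((List.range m).filter fun k => q ((t + j * k) % p)).length := by
  rw [posList, List.filter_map, List.length_map]; rfl

/-- The smallest listed value `≥ lb`, or `dflt` if there is none. [folklore] -/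
def nextPosL (lb : ℕ) (PL : List ℕ) (dflt : ℕ) : ℕ := (PL.filter fun x => decide (lb ≤ x)).foldr (fun x acc => min x acc) dflt

/-- Walk through the listed positions in increasing order (`fuel` steps from the lower bound `lb`) and return the first one whose prefix residue
`pos − #{listed positions below pos}` is ODD (`n` if none / fuel exhausted): the window `[0, n₁)` of case β₂ must end at or before it.  The candidate is
bound by a β-redex so the kernel evaluates it once. [folklore] -/
def oddMinAuxL (p n : ℕ) (PL : List ℕ) : ℕ → ℕ → ℕ
  | 0, _ => n
  | fuel + 1, lb =>
    (fun x => if x = p then n else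
      if (x - (PL.filter fun y => decide (y < x)).length) % 2 = 1 then x else oddMinAuxL p n PL fuel (x + 1))
      (nextPosL lb PL p)

/-- `oddMinL p n m PL`: the bound of case β₂ (see `oddMinAuxL`) with fuel `m + 1`. [folklore] -/
def oddMinL (p n m : ℕ) (PL : List ℕ) : ℕ := oddMinAuxL p n PL (m + 1) 0

/-- If every listed position below `n₁` has an EVEN prefix residue (and `n₁ ≤ n`) then `n₁ ≤ oddMinAuxL …` for every fuel and lower bound. [folklore] -/
theorem le_oddMinAuxL {p n n₁ : ℕ} {PL : List ℕ} (hn : n₁ ≤ n)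
    (hW : ∀ x ∈ PL, x < n₁ → 2 ∣ x - (PL.filter fun y => decide (y < x)).length) :
    ∀ fuel lb, n₁ ≤ oddMinAuxL p n PL fuel lb := by
  intro fuel
  induction fuel with
  | zero => intro lb; exact hn
  | succ f ih =>
    intro lb
    show n₁ ≤ (fun x => if x = p then n else
      if (x - (PL.filter fun y => decide (y < x)).length) % 2 = 1 then x else oddMinAuxL p n PL f (x + 1)) (nextPosL lb PL p)
    simp only []
    split_ifs with h1 h2
    · exact hn
    · rcases foldr_min_eq_or_mem (PL.filter fun x => decide (lb ≤ x)) id p with h | ⟨x, hx, h⟩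
      · exact absurd h h1
      · rw [nextPosL] at h2 ⊢
        simp only [id] at h
        rw [h] at h2 ⊢
        have hxPL : x ∈ PL := (List.mem_filter.1 hx).1
        by_contra hlt
        have hev := hW x hxPL (by omega)
        omega
    · exact ih _

/-- `n₁ ≤ oddMinL` under the window-1 prefix law with global ranks (listed form). [folklore] -/
theorem le_oddMinL {p n m n₁ : ℕ} {PL : List ℕ} (hn : n₁ ≤ n)
    (hW : ∀ x ∈ PL, x < n₁ → 2 ∣ x - (PL.filter fun y => decide (y < x)).length) :
    n₁ ≤ oddMinL p n m PL := le_oddMinAuxL hn hW _ _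

/-- Largest listed position `≥ n₁` (default `0`), for the range of admissible starts `s` of the second window. [folklore] -/
def outMaxL (n₁ : ℕ) (PL : List ℕ) : ℕ := (PL.filter fun x => decide (n₁ ≤ x)).foldr (fun x acc => max x acc) 0

/-- The `s`-loop of the case-β₂ checker over the admissible range `[lo, hi]`: for each `s` it must FAIL that `I₂ = {(s+i) mod p : i < n − n₁}` misses
`I₁ = [0,n₁)`, `n₁ ∉ I₂`, `(s + n₂) mod p ∉ I₁`, every position lies in `I₁ ∪ I₂`, and the `I₂`-offsets of the positions in `I₂` satisfy the prefix law
with run length `2`. [folklore] -/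
def tableBeta2S (p n m j t n₁ : ℕ) (PL : List ℕ) (lo hi : ℕ) : Bool :=
  (List.range' lo (hi + 1 - lo)).all fun s =>
    !(PL.all fun x => decide (x < n₁) || decide ((x + p - s) % p < n - n₁)) ||
    !(decide (∀ i < n - n₁, n₁ ≤ (s + i) % p)) || !(decide (n - n₁ ≤ (n₁ + p - s) % p)) || !(decide (n₁ ≤ (s + (n - n₁)) % p)) ||
    !(prefixOK 2 (((range m).filter fun k => ((t + j * k) % p + p - s) % p < n - n₁).image fun k => ((t + j * k) % p + p - s) % p))

/-- **Case-β₂ table checker, `n₁`-loop** (`Bool`), for fixed `j, t`, the position list `PL` and the precomputed bound `bmin`: for every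
`1 ≤ n₁ ≤ bmin` that is not a position and has `n₁ + #{positions < n₁}` even, run the `s`-loop over `[max (n₁+1) (outMax + 1 − n₂), min outMin (p − 1 − n₂)]`.
[folklore] -/
def tableBeta2Core (p n m j t bmin : ℕ) (PL : List ℕ) : Bool :=
  (List.range n).all fun n₁ => (n₁ == 0) || !(decide (n₁ ≤ bmin)) ||
    (PL.any fun x => x == n₁) ||
    !((n₁ + (PL.filter fun x => decide (x < n₁)).length) % 2 == 0) ||
    tableBeta2S p n m j t n₁ PL (max (n₁ + 1) (outMaxL n₁ PL + 1 - (n - n₁))) (min (nextPosL n₁ PL (p - 1)) (p - 1 - (n - n₁)))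

/-- **Case-β₂ table checker** (`Bool`): for all `j ∉ J` and `t`, the inner loops with the position list and the bound `oddMinL` passed as arguments (so the
kernel evaluates them once per `(j, t)`). [folklore] -/
def tableBeta2 (p n m : ℕ) (J : Finset ℕ) : Bool :=
  (List.range p).all fun j => decide (j ∈ J) || (List.range p).all fun t =>
    tableBeta2Core p n m j t (oddMinL p n m (posList p m j t)) (posList p m j t)

/-- **Meaning of the case-β₂ checker.** [folklore] -/
theorem tableBeta2_spec {p n m : ℕ} {J : Finset ℕ} (h : tableBeta2 p n m J = true) :
    ∀ j < p, ∀ t < p, ∀ n₁, 1 ≤ n₁ → n₁ < n → n₁ ≤ oddMinL p n m (posList p m j t) → n₁ ∉ (range m).image (fun k => (t + j * k) % p) →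
      (n₁ + #((range m).filter fun k => (t + j * k) % p < n₁)) % 2 = 0 →
      prefixOK 2 (((range m).filter fun k => (t + j * k) % p < n₁).image fun k => (t + j * k) % p) = true →
      ∀ s < p, (∀ k < m, (t + j * k) % p < n₁ ∨ ((t + j * k) % p + p - s) % p < n - n₁) →
      (∀ i < n - n₁, n₁ ≤ (s + i) % p) → n - n₁ ≤ (n₁ + p - s) % p → n₁ ≤ (s + (n - n₁)) % p →
      prefixOK 2 (((range m).filter fun k => ((t + j * k) % p + p - s) % p < n - n₁).image fun k => ((t + j * k) % p + p - s) % p) = true →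
      j ∈ J := by
  intro j hj t ht n₁ hn1 hn1n hbmin hnpos hpar _hpre1 s hs hcov hdisj hn1I2 hend hpre2
  rw [tableBeta2, List.all_eq_true] at h
  have h1 := h j (List.mem_range.2 hj)
  rw [Bool.or_eq_true, decide_eq_true_eq, List.all_eq_true] at h1
  rcases h1 with hJ | h1
  · exact hJ
  exfalso
  have h2 := h1 t (List.mem_range.2 ht)
  rw [tableBeta2Core, List.all_eq_true] at h2
  have h3 := h2 n₁ (List.mem_range.2 hn1n)
  rw [Bool.or_eq_true, Bool.or_eq_true, Bool.or_eq_true, Bool.or_eq_true] at h3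
  rcases h3 with (((h4 | h4) | h4) | h4) | h4
  · rw [beq_iff_eq] at h4; omega
  · rw [Bool.not_eq_true', decide_eq_false_iff_not] at h4; exact h4 hbmin
  · rw [List.any_eq_true] at h4
    obtain ⟨x, hx, hxn⟩ := h4
    rw [beq_iff_eq] at hxn
    obtain ⟨k, hk, hkx⟩ := mem_posList.1 hx
    exact hnpos (Finset.mem_image.2 ⟨k, Finset.mem_range.2 hk, by rw [hkx, hxn]⟩)
  · rw [Bool.not_eq_true', beq_eq_false_iff_ne] at h4
    exact h4 (by rw [length_filter_posList, ← card_filter_range_eq_length]; exact hpar)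
  -- the admissible range of s
  have hp0 : 0 < p := by omega
  set n₂ := n - n₁ with hn₂
  have hsn1 : n₁ + 1 ≤ s := by
    have h0 := hdisj 0 (by omega)
    rw [add_zero, Nat.mod_eq_of_lt hs] at h0
    by_contra hlt
    have hs1 : s = n₁ := by omega
    rw [hs1, show n₁ + p - n₁ = p by omega, Nat.mod_self] at hn1I2
    omega
  have hsn2 : s + n₂ ≤ p - 1 := by
    by_contra hgt
    rcases Nat.lt_or_ge p (s + n₂) with hlt | hge
    · have h := hdisj (p - s) (by omega)
      rw [show s + (p - s) = p by omega, Nat.mod_self] at h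
      omega
    · have heq : s + n₂ = p := by omega
      rw [heq, Nat.mod_self] at hend
      omega
  have hout : ∀ x ∈ (posList p m j t).filter (fun x => decide (n₁ ≤ x)), s ≤ x ∧ x ≤ s + n₂ - 1 := by
    intro x hx
    rw [List.mem_filter, decide_eq_true_eq] at hx
    obtain ⟨k, hk, hkx⟩ := mem_posList.1 hx.1
    have hxp : x < p := by rw [← hkx]; exact Nat.mod_lt _ hp0
    rcases hcov k hk with hlt | hlt
    · omega
    · rw [hkx] at hlt
      by_cases hsx : s ≤ x
      · rw [show x + p - s = (x - s) + p by omega, Nat.add_mod_right, Nat.mod_eq_of_lt (by omega)] at hlt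
        omega
      · rw [Nat.mod_eq_of_lt (by omega)] at hlt
        omega
  have hlo : max (n₁ + 1) (outMaxL n₁ (posList p m j t) + 1 - (n - n₁)) ≤ s := by
    apply max_le hsn1
    have : outMaxL n₁ (posList p m j t) ≤ s + n₂ - 1 :=
      foldr_max_le (f := id) (fun x hx => by simpa using (hout x hx).2) (by omega)
    omega
  have hhi : s ≤ min (nextPosL n₁ (posList p m j t) (p - 1)) (p - 1 - (n - n₁)) := by
    apply le_min _ (by omega)
    exact le_foldr_min (f := id) (fun x hx => by simpa using (hout x hx).1) (by omega)
  rw [tableBeta2S, List.all_eq_true] at h4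
  have h5 := h4 s (by rw [List.mem_range'_1]; omega)
  rw [Bool.or_eq_true, Bool.or_eq_true, Bool.or_eq_true, Bool.or_eq_true, Bool.not_eq_true', Bool.not_eq_true', Bool.not_eq_true',
    Bool.not_eq_true', Bool.not_eq_true'] at h5
  rcases h5 with (((h6 | h6) | h6) | h6) | h6
  · rw [Bool.eq_false_iff] at h6
    apply h6
    rw [List.all_eq_true]
    intro x hx
    rw [Bool.or_eq_true, decide_eq_true_eq, decide_eq_true_eq]
    obtain ⟨k, hk, hkx⟩ := mem_posList.1 hx
    rw [← hkx]
    exact hcov k hk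
  · rw [decide_eq_false_iff_not] at h6; exact h6 hdisj
  · rw [decide_eq_false_iff_not] at h6; exact h6 hn1I2
  · rw [decide_eq_false_iff_not] at h6; exact h6 hend
  · rw [hpre2] at h6; exact Bool.noConfusion h6

end TableTwoWindows

end Summit.MatrixMultiplication.OmegaCensus.CubeNB
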